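import Literature.Claims.NS.Kyritsis2021
import Literature.Claims.NS.Kyritsis2017
import Literature.Analysis.FluidPDE.ClassicalNSEnergyEqualityNonnegViscosity
import Literature.Analysis.FluidPDE.TaoLocalisationContinuation
import Summits.NavierStokesRegularity.NavierStokesRegularity.Theorems.SoloSalvageKyritsis2021
import HarnessLib

/-!
# Solo salvage for claims C03b `Kyritsis2021` (Step 2) and C03c `Kyritsis2017` (Step 1) — the
# energy inequality `E(t) ≤ E(s)` in the Beale–Kato–Majda class for EVERY `ν ≥ 0`, kernel

Claim skeletons: `Literature/Claims/NS/Kyritsis2021.lean` (C03b, `Step_2` = eqs. (8)–(13) pp. 9–10: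
the energy identity/inequality for class solutions on `[0,T)` and `[0,∞)`, `ν ≥ 0`, «for inviscid
fluids E(t) = E(0)») and `Literature/Claims/NS/Kyritsis2017.lean` (C03c, `Step_1 := Kyritsis2021.Step_2`).
The sibling file `SoloSalvageKyritsis2021.lean` (seat g0, p464800) discharged the `ν > 0` clauses
(`step2_of_pos_viscosity`) and left the `ν = 0` clause «classical (Majda–Bertozzi Prop. 1.13 (iii)),
not re-derived». With Leray's energy identity now in the tree for every `ν ≥ 0`
(`Literature.Analysis.FluidPDE.IsClassicalNSSolutionOn.energyEq_of_finiteEnergy_nonneg`, Euler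
included) this file (seat g3) discharges the typed steps in full:

* `energy_antitone_of_isLocalClassSolution_nonneg` / `…_of_isGlobalClassSolution_nonneg` — `E(t) ≤ E(s)`
  for class solutions, `0 ≤ ν` (the class supplies finite energy, `∇u ∈ L²_{t,x}` and `u ∈ L³_{t,x}`
  on every closed sub-slab);
* `kyritsis2021_step2_holds : Literature.Claims.NS.Kyritsis2021.Step_2`;
* `kyritsis2017_step1_holds : Literature.Claims.NS.Kyritsis2017.Step_1` (the same proposition).

Solo lane (no item). WHAT THIS IS NOT: not a claim about NS regularity or blow-up; not a claim about
any author beyond the typed locator.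
-/

noncomputable section

set_option linter.dupNamespace false

open MeasureTheory Set Filter
open scoped ENNReal NNReal ContDiff

namespace Summit.NavierStokesRegularity.NavierStokesRegularity.Theorems.Kyritsis2021Salvage

open Literature.Analysis.FluidPDE Literature.Claims.NS.Kyritsis2021

/-- **`∇u ∈ L²_{t,x}` on a bounded slab from the class**: if all Sobolev norms of `u` are bounded on
`[0, S]` then `∫₀^S∫|∇u|²_F ≤ 3 C₁ S < ∞` (`|∇u|²_F ≤ 3‖D¹u‖²`, the `n = 1` clause). [folklore] -/
theorem lintegral_frobeniusNormSq_lt_top_of_hasBoundedSobolevNormsOn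
    {u : ℝ → EuclideanSpace ℝ (Fin 3) → EuclideanSpace ℝ (Fin 3)} {S : ℝ}
    (hB : HasBoundedSobolevNormsOn (Icc 0 S) u) :
    ∫⁻ τ in Ioo 0 S, ∫⁻ x, ENNReal.ofReal (frobeniusNormSq (fderiv ℝ (u τ) x)) < ⊤ := by
  obtain ⟨C₁, hC₁⟩ := hB 1
  have hle : ∫⁻ τ in Ioo 0 S, ∫⁻ x, ENNReal.ofReal (frobeniusNormSq (fderiv ℝ (u τ) x)) ≤
      ∫⁻ _ in Ioo 0 S, 3 * (C₁ : ℝ≥0∞) :=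
    setLIntegral_mono measurable_const fun τ hτ =>
      (lintegral_frobeniusNormSq_le_three_mul_iteratedFDeriv_one (u τ)).trans
        (by gcongr; exact hC₁ τ (Ioo_subset_Icc_self hτ))
  refine hle.trans_lt ?_
  rw [setLIntegral_const, Real.volume_Ioo]
  exact ENNReal.mul_lt_top (ENNReal.mul_lt_top (by norm_num) ENNReal.coe_lt_top) ENNReal.ofReal_lt_top

/-- **The energy inequality for class solutions on `[0,T)`, every `ν ≥ 0`**: `E(t) ≤ E(s)` for
`0 ≤ s ≤ t < T` (eq. (13), p. 10; for `ν = 0` with equality, (12)). Proof: restrict to the closed slab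
`[0, t]`; the class gives finite energy (`n = 0`), `∇u ∈ L²_{t,x}` (`n = 1`) and hence `u ∈ L³_{t,x}`;
Leray's identity `½‖u(t)‖₂² + ν∫ₛᵗ∫|∇u|²_F = ½‖u(s)‖₂²` (tree, `ν ≥ 0`) and `ν∫∫|∇u|² ≥ 0`. -/
theorem energy_antitone_of_isLocalClassSolution_nonneg {ν T : ℝ} (hν : 0 ≤ ν)
    {u : ℝ → EuclideanSpace ℝ (Fin 3) → EuclideanSpace ℝ (Fin 3)}
    {p : ℝ → EuclideanSpace ℝ (Fin 3) → ℝ} (hsol : IsLocalClassSolution ν T u p)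
    {s t : ℝ} (hs : s ∈ Ico 0 T) (ht : t ∈ Ico 0 T) (hst : s ≤ t) :
    energy u t ≤ energy u s := by
  rcases hst.eq_or_lt with h | hlt
  · rw [h]
  have ht0 : 0 < t := hs.1.trans_lt hlt
  have hcl : IsClassicalNSSolutionOn (Icc 0 t) ν 0 u p :=
    hsol.1.mono (fun τ hτ => ⟨hτ.1, hτ.2.trans_lt ht.2⟩) (uniqueDiffOn_Icc ht0)
  obtain ⟨A, hAt, hA⟩ := finiteEnergy_of_isLocalClassSolution hsol ht.2
  have hgrad := lintegral_frobeniusNormSq_lt_top_of_hasBoundedSobolevNormsOn (hsol.2 t ht.2)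
  have hu₃ := hcl.lintegral_enorm_pow_three_lt_top hAt.ne hA hgrad
  have hid := hcl.energyEq_of_finiteEnergy_nonneg hν ht0 hAt.ne hA hgrad hu₃ hs.1 hlt.le le_rfl
  have hD : 0 ≤ ν * (∫⁻ τ in Ioo s t, ∫⁻ x,
      ENNReal.ofReal (frobeniusNormSq (fderiv ℝ (u τ) x))).toReal :=
    mul_nonneg hν ENNReal.toReal_nonneg
  have hKE : VectorCalculus.kineticEnergy (u t) ≤ VectorCalculus.kineticEnergy (u s) := by linarith
  have hmem : ∀ τ ∈ Icc 0 t, MemLp (u τ) 2 volume := fun τ hτ =>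
    memLp_two_of_lintegral_lt_top (hcl.contDiff_velocity hτ).continuous ((hA τ hτ).trans_lt hAt)
  exact energy_le_energy_of_kineticEnergy_le (hmem s ⟨hs.1, hlt.le⟩) (hmem t ⟨ht0.le, le_rfl⟩) hKE

/-- **The energy inequality for global class solutions, every `ν ≥ 0`**: `E(t) ≤ E(s)` for
`0 ≤ s ≤ t` (a global class solution restricts to a class solution on `[0, t+1)`). -/
theorem energy_antitone_of_isGlobalClassSolution_nonneg {ν : ℝ} (hν : 0 ≤ ν)
    {u : ℝ → EuclideanSpace ℝ (Fin 3) → EuclideanSpace ℝ (Fin 3)}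
    {p : ℝ → EuclideanSpace ℝ (Fin 3) → ℝ} (hsol : IsGlobalClassSolution ν u p)
    {s t : ℝ} (hs : 0 ≤ s) (hst : s ≤ t) : energy u t ≤ energy u s := by
  have hloc : IsLocalClassSolution ν (t + 1) u p :=
    ⟨hsol.1.mono (fun τ hτ => hτ.1) (uniqueDiffOn_Ico 0 (t + 1)), fun T'' _ => hsol.2 T''⟩
  exact energy_antitone_of_isLocalClassSolution_nonneg hν hloc ⟨hs, by linarith⟩
    ⟨hs.trans hst, by linarith⟩ hst

/-- **Step 2 of C03b is TRUE — kernel-discharged for every `ν ≥ 0`** (eqs. (8)–(13), pp. 9–10;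
Majda–Bertozzi Prop. 1.13 (1.80); Leray 1934 (3.4)): both clauses of the typed `Step_2`, the energy
inequality for class solutions on `[0,T)` and on `[0,∞)`, Euler (`ν = 0`) included.
[cite: Kyritsis2021b, eqs. (8)–(13), pp. 9–10] [cite: MajdaBertozziCUP2002, Prop. 1.13 (1.80) p. 28] -/
theorem kyritsis2021_step2_holds : Literature.Claims.NS.Kyritsis2021.Step_2 := fun _ν hν =>
  ⟨fun _ _ _ _ hsol _ hs _ ht hst => energy_antitone_of_isLocalClassSolution_nonneg hν hsol hs ht hst,
    fun _ _ hsol _ _ hs hst => energy_antitone_of_isGlobalClassSolution_nonneg hν hsol hs hst⟩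

/-- **Step 1 of C03c is TRUE — kernel** (K-I, eqs. (8)–(13) p. 311: the same energy step, typed as
`Kyritsis2017.Step_1 := Kyritsis2021.Step_2`). [cite: Kyritsis2017, eqs. (8)–(13), p. 311] -/
theorem kyritsis2017_step1_holds : Literature.Claims.NS.Kyritsis2017.Step_1 :=
  kyritsis2021_step2_holds

end Summit.NavierStokesRegularity.NavierStokesRegularity.Theorems.Kyritsis2021Salvage

end
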